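import Summits.QuantumFields.BalabanUV.Beta.GAN24.TripleWardReadout
import Summits.QuantumFields.BalabanUV.Beta.GAN24.WardRemainderEndThreeCoDress

/-!
# `BalabanUV.Beta.GAN24.TripleFaceCharge` — binder row G-an2-4 ∕ (CONV-C), W-slot CT-W, route «WC-TL» ∕ (Q-R) «QR-LL», rows (LT) ∕ (DIV) ∕ (DL):
# **THE TRIPLE FACE CHARGE OF A BORN SUB-LETTER AND THE DISPLAYED LAYER BOUND** — PART 2 of leaf-03 g64's «TRIPLE WARD READ-OUT»:
# (§1) the object `push₃ Γ Γ Γ S` (`Γ = gaugeWt L`, `L = Lc^{k+1}`) in closed form — the table read is the BLOCK SUM OF THE SLOT DIVERGENCE, so the object VANISHES on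
# co-closed letters; (§2–§3) a triple coarse difference costs `(2(d+1))³`; (§4) **the END's displayed layer bound `hLT` on the transported sub-letter
# `L^{3(d+1)}·push₃ T T T S` (`WardRemainderEndThreeCoDress.wLocStencil_unitS_of_layer_coDress ∕ _three`) FORCES `|push₃ Γ Γ Γ S| ≤ (2(d+1))³·K·θ^{k+1}`
# — the `L`-powers cancel EXACTLY** (`c³·L^{3(d+1)} = 1`, `c` the chain's coarse Ward constant); (§5) at `d = 3`, token-exact: `≤ 512·K·(√(Lc^{k+1}))⁻¹`, its
# CONTRAPOSITIVE = a PER-LABEL KERNEL REFUTATION CRITERION for `hLT(m,k,v;K)` by ONE born-level number, and `¬∃` LEVEL-FREE `K` for any sub-letter family whose triple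
# face charge stays `≥ c₀ > 0` along the depths (G-an2-4 formalisation swarm → CRUX TEAM (2), leaf prover `b2b-balaban-gan24-formalise-leaf-03`, gen 64, PART 2;
# addressed to the gan24-refuter's PRE-REGISTRATION (α⁹) «certificate ∕ kernel `Negative∕` lemma on a (DL) ∕ (Q-R) letter» and to the OWNER gan24-p1 g31's RULING A1 (i)
# consumer «a refuter's per-label ¬(Q-R) for the dressed literal»; PRIORITY NOTE: leaf-01 g69 recorded the inequality `sup|L^{3(d+1)}·push₃ T T T S| ≥ |Γ_L(S)|∕(2(d+1))³`
# («ROW-WARD thrice», `g69/NOTES-g69.md` 23:25Z, relayed in the OWNER g32's `DressedCubicPushNoContraction` header) before this file typed it)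

NOT IN PRINT; OUR BOOKKEEPING ([folklore] PART 1 `TripleWardReadout` BY NAME; leaf-01's `ChainTableLegCoClosed.tsum_ite_blk_eq_sum_box`, `ChainTableLegTelescopeCell.ffRead_zero`,
`StepDriftWitness.comp_zero_right`, an1's `KernelWardRelative.comp_zero_left`, `Push4.vertexW_apply`, the triangle inequality on `2(d+1)`-term sums, Mathlib's
`pow_unbounded_of_one_lt` ∕ `exists_pow_lt_of_lt_one`; generic `d` in §1–§4, `d = 3` in §5; 0 `def`, 0 cited facts, 0 `def … : Prop`, 0 sorry).  HONEST FRAMING (cell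
contract, verbatim): «discharging `BetaPertH` makes Bałaban's UV stability UNCONDITIONAL — a real constructive-QFT result; it is NOT the continuum limit and NOT the Clay
problem.»  HONEST DEPENDENCY (verbatim): «continuum YM on T⁴ ⇐ BetaPertH ∧ nine spine estimates (0/9 proved); BetaPertH ⇐ (D1) ∧ (D4) ∧ CAP+tail; G-an2-4 gates asym, D1
and NE2/3/4.»

## Why
The row record («(Q-R) dressed literal `d = 3`: top two levels bounded [tree]; DL tower NEGATIVE-BY-COUNT … not certified, not refuted», PRICING v3.50) rests on a COUNT of the
dressed tower.  PART 1's identity isolates the part of the transported letter that the count says diverges — its component along the three block-constant gauge modes —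
as an EXACT multiple `c³` of a born-level object, the letter pushed on three gauge-weight legs.  Hence (§4): ANY entry bound of the END's shape on the transported letter
is, verbatim up to `(2(d+1))³`, a bound on that born-level object, and the normalisation `L^{3(d+1)}` of the END cancels `c³` exactly.  So the displayed rate
`K·θ^{k+1}` (`θ = (√Lc)⁻¹` at `d = 3`) must be carried by the BORN sub-letter's triple face charge itself: (LT)∕(Q-R) for a sub-letter family can hold with a level-free
`K` ONLY IF its triple face charges decay geometrically in the depth `k` (§5) — a statement with no leg, no transport and no resolvent beyond the born letter, checkable
per label by a finite computation (the refuter's certificate target) and identically TRUE-BY-ZERO on co-closed letters (§1; row (CC)).  What is NOT here: the size of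
the literal's bad sub-letters' triple face charge — OPEN; two located inputs received before filing: (i) leaf-01 g69∕g70 (`WilsonTripleGaugeZero`, INTENT l.48343): on
the span of translates of the born WILSON table the triple gauge read is IDENTICALLY ZERO (third-order Ward–Takahashi at the trivial configuration) — the criterion can
bite only on the NON-Wilson components of the literal's source letter `σ_m` and on its PARTIAL TRANSPORTS (PART 3 `TripleFaceChargeNested`); (ii) the OWNER gan24-p1 g32
(W2 l.48281, W4 l.48355): engine E41 ACCEPTED and designed on this normalisation (`Γ(B₁,B₂,B₃) = g_{B₂}ᵀ F_{B₁}(s) g_{B₃}`).  This file REFUTES NOTHING about the literal by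
itself; it converts the tower count into a born-level criterion, in the kernel.

## What
* §1 `tsum_gaugeWt_mul_eq`, **`vertexW_gaugeWt_apply_eq_finsetSum_divV`** (`vertexW Γ S κ₀ U x z a b = Σ_{v ∈ box L} divV S (L•U + toSite v) x z a b`, no hypothesis
  on `S`), **`push₃_gaugeWt_table_eq_zero_of_divFree`** (`divV S ≡ 0 ⟹ push₃ l r Γ S κ₀ U = 0`, ANY kernel legs).
* §2 `abs_codiff₁_le`, `abs_divV_apply_le` (`2(d+1)` terms each); §3 **`abs_readout_le_of_entry_bound`** (three Ward-covariant legs, PART 1 §3: an entry bound `M` on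
  `push₃ l r w S` gives `|c_w·(c_l·(c_r·push₃ Γ_l Γ_r Γ_w S))| ≤ (2(d+1))³·M`).
* §4 **`abs_push₃_gauge_cube_le_of_biLoc`** — THE CHAIN, `L`-FREE: for every in-block root, `m`, `k`, `LocStencil S Cs δ` (`δ > 0`), a profile `E ν U ≤ E₀` and a rate
  `r ≥ 0`: `(∀ ν U, BiLoc ((((Lc^(k+1):ℕ):ℝ)^{3(d+1)}) • push₃ T T T S ν U) U U (E ν U) r) ⟹ ∀ κ₀ U y z α₀ β₀, |push₃ Γ Γ Γ S κ₀ U y z (inl α₀) (inl β₀)| ≤ (2(d+1))³·E₀`;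
  **`abs_push₃_gauge_cube_le_of_layerBound`** — at the END's generic-`d` `hLT` profile `K·θ^{k+1}·e^{−min(κ₁∕2,δ₁∕2)‖y_v − U‖₁}`, rate `κ₁∕4`: `≤ (2(d+1))³·(K·θ^{k+1})`.
* §5 (`d = 3`, the END `wLocStencil_unitS_coDress_three`'s `hLT` row TOKEN FOR TOKEN as hypothesis): **`abs_push₃_gauge_cube_le_of_layerBound_three`** (`≤ 512·K·(√(Lc^(k+1)))⁻¹`);
  **`not_layerBound_three_of_lt_tripleFaceCharge`** — THE PER-LABEL REFUTATION CRITERION: ONE sextuple `(κ₀, U, y, z, α₀, β₀)` with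
  `512·K·(√(Lc^(k+1)))⁻¹ < |push₃ Γ Γ Γ S κ₀ U y z (inl α₀) (inl β₀)|` REFUTES the sub-letter's `hLT` with constant `K`;
  **`not_exists_levelFree_layerBound_three`** — NO LEVEL-FREE CONSTANT: a depth-indexed family `S k` of letters (each `LocStencil` at a positive rate) whose triple face
  charges at blocking `Lc^{k+1}` stay `≥ c₀ > 0` admits NO `K` serving `hLT` at every depth (`2 ≤ Lc`; centres and rates may even vary with `k`);
  `not_exists_levelFree_layerBound_geometric` — the same for any ratio `0 ≤ θ < 1`, generic `d`.
HONEST: identities + counting; NO size of any letter asserted; the criterion's premise for the literal's bad sub-letters is NOT supplied (OPEN, engine-checkable); decides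
nothing about (Q-R) ∕ (DIV) ∕ (DL) ∕ K-LL-4′ for the literal by itself; NOTHING of (LT) ∕ (LAY) ∕ (S) ∕ «T2Shape» discharged; NEVER «G-an2-4 closed» as (CONV-C); NOT D1,
NOT `BetaPertH`, NOT continuum, NOT Clay; not in print — our bookkeeping.  2026-08-23; no existing file touched.
-/

noncomputable section

open Finset
open scoped BigOperators
open Literature.MathematicalPhysics.QuantumFieldTheory
open Literature.MathematicalPhysics.QuantumFieldTheory.Balaban1983to89
open Literature.MathematicalPhysics.QuantumFieldTheory.Balaban1983to89.Beta
open B12Sec2to5 (l1 l1_nonneg)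
open ExpKernelCalculus (MKer Decays BiLoc)
open AffineAveraging (Form0 Form1 box toSite dz codiff₁ blockSum)
open AveragingContours (blk)
open OneStepResolventKernel (Fib LocStencil)
open KernelWard (divV)
open Summit.QuantumFields.BalabanUV.Beta.KernelWardRelative (gaugeWt)
open Summit.QuantumFields.BalabanUV.Beta.GAN24.Push4 (vertexW vertexW_apply)
open Summit.QuantumFields.BalabanUV.Beta.GAN24.Push4Bounds (LegDecay LegDecay.abs_le LegDecay.summable)
open Summit.QuantumFields.BalabanUV.Beta.GAN24.Push4Iter (LegFam legChain)
open Summit.QuantumFields.BalabanUV.Beta.GAN24.Push3 (push₃ push₃_def)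
open Summit.QuantumFields.BalabanUV.Beta.GAN24.RespStepBmDecompExact (respStepBmSeq)
open Summit.QuantumFields.BalabanUV.Beta.GAN24.PushRowCoarseWardChain (sum_legChain_sub_eq_gaugeWt)
open Summit.QuantumFields.BalabanUV.Beta.GAN24.DressedLegSeamLowerBound (abs_gaugeWt_le_one)
open Summit.QuantumFields.BalabanUV.Beta.GAN24.ChainTableLegCoClosed (tsum_ite_blk_eq_sum_box)
open Summit.QuantumFields.BalabanUV.Beta.GAN24.ChainTableLegTelescopeCell (ffRead_zero)
open Summit.QuantumFields.BalabanUV.Beta.GAN24.TripleWardReadout (codiff₁_codiff₁_divV_push₃_eq codiff₁_codiff₁_divV_push₃_chain_eq exists_legDecay_legChain)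

namespace Summit.QuantumFields.BalabanUV.Beta.GAN24.TripleFaceCharge

variable {d : ℕ}

/-! ## §1 The object: the table read against the block-indicator gauge is the block sum of the slot divergence; blind to co-closed letters -/
section Closed

variable {L : ℕ}

open Classical in
/-- [folklore] **READING A FUNCTION AGAINST THE BLOCK-INDICATOR GAUGE** (`gaugeWt L U = dz 𝟙_{B_L(U)}`, two finite-support series; leaf-01's `tsum_ite_blk_eq_sum_box`):
`Σ'_u gaugeWt L U κ u·f u = Σ_{v ∈ box L} (f (L•U + toSite v − e_κ) − f (L•U + toSite v))` — the function's backward differences summed over the block. -/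
theorem tsum_gaugeWt_mul_eq (hL : 1 ≤ L) (U : Fin (d + 1) → ℤ) (κ : Fin (d + 1)) (f : (Fin (d + 1) → ℤ) → ℝ) :
    ∑' u, gaugeWt L U κ u * f u
      = ∑ v ∈ box (d + 1) L, (f ((L : ℤ) • U + toSite v - AffineAveraging.unitVec κ) - f ((L : ℤ) • U + toSite v)) := by
  have e : ∀ u, gaugeWt L U κ u * f u
      = (if blk L (u + AffineAveraging.unitVec κ) = U then f u else 0) - (if blk L u = U then f u else 0) := fun u => by
    simp only [KernelWardRelative.gaugeWt, AveragingWardStencils.b6UnitVec_eq]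
    split_ifs <;> ring
  have hsupp : ∀ (g : (Fin (d + 1) → ℤ) → ℝ), Summable fun u : Fin (d + 1) → ℤ => (if blk L u = U then g u else 0) := fun g =>
    summable_of_ne_finset_zero (s := (box (d + 1) L).image (fun v => (L : ℤ) • U + toSite v)) (fun u hu => by
      have hb : blk L u ≠ U := fun hb => hu (Finset.mem_image.2
        ⟨AveragingContours.off L u, AveragingContours.off_mem_box hL u, by rw [← hb, AveragingContours.blk_add_off hL u]⟩)
      rw [if_neg hb])
  have hs2 := hsupp f
  have hs1 : Summable fun u : Fin (d + 1) → ℤ => (if blk L (u + AffineAveraging.unitVec κ) = U then f u else 0) := by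
    have h2 := (Equiv.addRight (AffineAveraging.unitVec κ)).summable_iff.2 (hsupp fun u' => f (u' - AffineAveraging.unitVec κ))
    refine h2.congr fun u => ?_
    simp only [Function.comp_apply, Equiv.coe_addRight, add_sub_cancel_right]
  -- the shifted indicator series: re-index `u = u' − e_κ`
  have hshift : ∑' u, (if blk L (u + AffineAveraging.unitVec κ) = U then f u else 0)
      = ∑' u', (if blk L u' = U then f (u' - AffineAveraging.unitVec κ) else 0) := by
    rw [← (Equiv.subRight (AffineAveraging.unitVec κ)).tsum_eq]
    refine tsum_congr fun u' => ?_
    simp only [Equiv.subRight_apply, sub_add_cancel]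
  rw [tsum_congr e, hs1.tsum_sub hs2, hshift, tsum_ite_blk_eq_sum_box hL U, tsum_ite_blk_eq_sum_box hL U f, ← Finset.sum_sub_distrib]

/-- NOT IN PRINT; OUR BOOKKEEPING.  **THE TABLE READ IN CLOSED FORM**: the letter's slot read against the block-indicator gauge leg `Γ = fun _ ↦ gaugeWt L` is THE BLOCK SUM
OF an2's SLOT DIVERGENCE — `vertexW Γ S κ₀ U x z a b = Σ_{v ∈ box L} divV S (L•U + toSite v) x z a b` (no hypothesis on `S`: both series have finite support; leaf-02∕leaf-01's
slot summation by parts `GaugeTableSlotByParts.vertexW_dz_eq_tsum_mul_divV` at the indicator potential).  So `push₃ l r Γ S κ₀ U` is the kernel-leg sandwich of the letter's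
NET FLUX out of the block `B_L(U)` — leaf-03 g62's «FLUX-REC» object `Σ_{B} divV S` (`BlockDivergenceFlux.boxSum_divV_eq_faceFlux` for its face form). -/
theorem vertexW_gaugeWt_apply_eq_finsetSum_divV (hL : 1 ≤ L) (S : Fin (d + 1) → (Fin (d + 1) → ℤ) → MKer (d + 1) (Fib d))
    (κ₀ : Fin (d + 1)) (U x z : Fin (d + 1) → ℤ) (a b : Fib d) :
    vertexW (fun _ => gaugeWt L) S κ₀ U x z a b = ∑ v ∈ box (d + 1) L, divV S ((L : ℤ) • U + toSite v) x z a b := by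
  rw [vertexW_apply]
  have e : ∀ κ, ∑' u, gaugeWt L U κ u * S κ u x z a b
      = ∑ v ∈ box (d + 1) L, (S κ ((L : ℤ) • U + toSite v - AffineAveraging.unitVec κ) x z a b - S κ ((L : ℤ) • U + toSite v) x z a b) :=
    fun κ => tsum_gaugeWt_mul_eq hL U κ (fun u => S κ u x z a b)
  rw [Finset.sum_congr rfl (fun κ _ => e κ), Finset.sum_comm]
  refine Finset.sum_congr rfl fun v _ => ?_
  simp only [KernelWard.divV, Finset.sum_apply, Pi.sub_apply, AveragingWardStencils.b6UnitVec_eq]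

/-- NOT IN PRINT; OUR BOOKKEEPING.  **THE TRIPLE READ-OUT IS BLIND TO CO-CLOSED LETTERS**: if `divV S ≡ 0` (row (CC)'s good letters — interior and non-persistent-face labels,
`TableSlotCoDress` ∕ `ChainTableLegCoClosed`), then `push₃ l r Γ S κ₀ U = 0` for ANY kernel legs `l r` — in particular PART 1's `push₃ Γ Γ Γ S` vanishes: the criterion of
§5 bites only on the flux-carrying (bad) sub-letters, consistently with (LT) surviving on the good ones. -/
theorem push₃_gaugeWt_table_eq_zero_of_divFree (hL : 1 ≤ L) (l r : Fin (d + 1) → (Fin (d + 1) → ℤ) → Fin (d + 1) → (Fin (d + 1) → ℤ) → ℝ)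
    {S : Fin (d + 1) → (Fin (d + 1) → ℤ) → MKer (d + 1) (Fib d)} (hdiv : ∀ u, divV S u = 0) (κ₀ : Fin (d + 1)) (U : Fin (d + 1) → ℤ) :
    push₃ l r (fun _ => gaugeWt L) S κ₀ U = 0 := by
  have hV : vertexW (fun _ => gaugeWt L) S κ₀ U = 0 := by
    funext x z a b
    rw [vertexW_gaugeWt_apply_eq_finsetSum_divV hL S κ₀ U x z a b, Pi.zero_apply]
    refine Finset.sum_eq_zero fun v _ => ?_
    rw [hdiv, Pi.zero_apply, Pi.zero_apply, Pi.zero_apply, Pi.zero_apply]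
  rw [push₃_def, hV, StepDriftWitness.comp_zero_right, KernelWardRelative.comp_zero_left, ffRead_zero]
end Closed

/-! ## §2 Counting: a coarse codifferential ∕ slot divergence of a bounded family is at most `2(d+1) ×` the bound -/

/-- [folklore] `|codiff₁ A y| ≤ 2(d+1)·M` if `|A α x| ≤ M`. -/
theorem abs_codiff₁_le {A : Fin (d + 1) → (Fin (d + 1) → ℤ) → ℝ} {M : ℝ} (h : ∀ α x, |A α x| ≤ M) (y : Fin (d + 1) → ℤ) :
    |codiff₁ A y| ≤ 2 * ((d : ℝ) + 1) * M := by
  simp only [AffineAveraging.codiff₁]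
  refine (Finset.abs_sum_le_sum_abs _ _).trans ?_
  have hterm : ∀ α ∈ (Finset.univ : Finset (Fin (d + 1))), |A α (y - AffineAveraging.unitVec α) - A α y| ≤ M + M := fun α _ =>
    (abs_sub _ _).trans (add_le_add (h α _) (h α y))
  refine (Finset.sum_le_card_nsmul _ _ _ hterm).trans ?_
  rw [Finset.card_univ, Fintype.card_fin, nsmul_eq_mul]; push_cast; linarith
/-- [folklore] `|divV V U x z a b| ≤ 2(d+1)·M` if `|V ν U′ x z a b| ≤ M`. -/
theorem abs_divV_apply_le {F : Type*} [Fintype F] {V : Fin (d + 1) → (Fin (d + 1) → ℤ) → MKer (d + 1) F} {M : ℝ}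
    (h : ∀ ν U x z a b, |V ν U x z a b| ≤ M) (U x z : Fin (d + 1) → ℤ) (a b : F) :
    |divV V U x z a b| ≤ 2 * ((d : ℝ) + 1) * M := by
  simp only [KernelWard.divV, Finset.sum_apply, Pi.sub_apply]
  refine (Finset.abs_sum_le_sum_abs _ _).trans ?_
  have hterm : ∀ ν ∈ (Finset.univ : Finset (Fin (d + 1))), |V ν (U - B6BondElimination.unitVec ν) x z a b - V ν U x z a b| ≤ M + M :=
    fun ν _ => (abs_sub _ _).trans (add_le_add (h ν _ x z a b) (h ν U x z a b))
  refine (Finset.sum_le_card_nsmul _ _ _ hterm).trans ?_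
  rw [Finset.card_univ, Fintype.card_fin, nsmul_eq_mul]
  push_cast
  linarith

/-! ## §3 An entry bound on the push, read through the triple read-out -/
section General

variable {l r w : Fin (d + 1) → (Fin (d + 1) → ℤ) → Fin (d + 1) → (Fin (d + 1) → ℤ) → ℝ}
  {S : Fin (d + 1) → (Fin (d + 1) → ℤ) → MKer (d + 1) (Fib d)} {Cl Cw Cs δ Cgl Cgw : ℝ}

/-- NOT IN PRINT; OUR BOOKKEEPING.  **AN ENTRY BOUND ON THE PUSH BOUNDS THE TRIPLE WARD READ-OUT** (PART 1 §3's class and Ward laws): if every entry of `push₃ l r w S` is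
`≤ M` in absolute value, then `|c_w·(c_l·(c_r·push₃ Γ_l Γ_r Γ_w S κ₀ U y z (inl α₀) (inl β₀)))| ≤ (2(d+1))³·M` — three coarse differences of `2(d+1)` terms each. -/
theorem abs_readout_le_of_entry_bound (hl : ∀ α x' κ x, |l α x' κ x| ≤ Cl) (hls : ∀ α x' κ, Summable fun x => l α x' κ x)
    (hrs : ∀ β z' κ, Summable fun z => r β z' κ z) (hw : ∀ κ' u' κ u, |w κ' u' κ u| ≤ Cw) (hS : LocStencil S Cs δ) (hδ : 0 < δ)
    {gl gr gw : (Fin (d + 1) → ℤ) → Fin (d + 1) → (Fin (d + 1) → ℤ) → ℝ} {cl cr cw : ℝ}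
    (hgl : ∀ x κ u, |gl x κ u| ≤ Cgl) (hgw : ∀ U κ u, |gw U κ u| ≤ Cgw)
    (hWl : ∀ x κ u, ∑ α, (l α (x - AffineAveraging.unitVec α) κ u - l α x κ u) = cl * gl x κ u)
    (hWr : ∀ z κ u, ∑ β, (r β (z - AffineAveraging.unitVec β) κ u - r β z κ u) = cr * gr z κ u)
    (hWw : ∀ U κ u, ∑ ν, (w ν (U - AffineAveraging.unitVec ν) κ u - w ν U κ u) = cw * gw U κ u)
    {M : ℝ} (hM : ∀ ν U x z a b, |push₃ l r w S ν U x z a b| ≤ M)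
    (κ₀ : Fin (d + 1)) (U y z : Fin (d + 1) → ℤ) (α₀ β₀ : Fin (d + 1)) :
    |cw * (cl * (cr * push₃ (fun _ => gl) (fun _ => gr) (fun _ => gw) S κ₀ U y z (Sum.inl α₀) (Sum.inl β₀)))|
      ≤ (2 * ((d : ℝ) + 1)) ^ 3 * M := by
  rw [← codiff₁_codiff₁_divV_push₃_eq hl hls hrs hw hS hδ hgl hgw hWl hWr hWw κ₀ U y z α₀ β₀]
  have h1 : ∀ z' α x, |divV (push₃ l r w S) U x z' (Sum.inl α) (Sum.inl β₀)| ≤ 2 * ((d : ℝ) + 1) * M := fun z' α x =>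
    abs_divV_apply_le hM U x z' _ _
  have h2 : ∀ (β : Fin (d + 1)) z', |codiff₁ (fun α x => divV (push₃ l r w S) U x z' (Sum.inl α) (Sum.inl β)) y| ≤ 2 * ((d : ℝ) + 1) * (2 * ((d : ℝ) + 1) * M) :=
    fun β z' => abs_codiff₁_le (fun α x => abs_divV_apply_le hM U x z' _ _) y
  have h3 := abs_codiff₁_le h2 z
  calc _ ≤ 2 * ((d : ℝ) + 1) * (2 * ((d : ℝ) + 1) * (2 * ((d : ℝ) + 1) * M)) := h3
    _ = (2 * ((d : ℝ) + 1)) ^ 3 * M := by ring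
end General

/-! ## §4 The chain: an entry bound of the END's shape on the transported letter bounds the born letter's triple face charge, `L`-free -/
section Chain

variable {Lc : ℕ} [NeZero Lc] {rr : Fin (d + 1) → ℕ}
  {S : Fin (d + 1) → (Fin (d + 1) → ℤ) → MKer (d + 1) (Fib d)} {Cs δ : ℝ}

/-- NOT IN PRINT; OUR BOOKKEEPING.  **THE END's NORMALISATION CANCELS THE WARD CONSTANTS EXACTLY**: for every in-block root `toSite rr`, base level `m`, depth `k`,
`LocStencil S Cs δ` (`δ > 0`), any profile `E ν U ≤ E₀` and rate `r ≥ 0`, with `T = legChain (respStepBmSeq (toSite rr) Lc) m k` on all three legs and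
`Γ = fun _ ↦ gaugeWt (Lc^(k+1))`:
`(∀ ν U, BiLoc (((((Lc^(k+1):ℕ):ℝ))^{3(d+1)}) • push₃ T T T S ν U) U U (E ν U) r) ⟹ |push₃ Γ Γ Γ S κ₀ U y z (inl α₀) (inl β₀)| ≤ (2(d+1))³·E₀`
for ALL blocks `U y z` and directions — PART 1 §3b (`c = (Lc^{(d+1)(k+1)})⁻¹`) ⨾ §3 ⨾ `c³·(Lc^(k+1))^{3(d+1)} = 1`.  The depth `k` survives ONLY through `E₀`. -/
theorem abs_push₃_gauge_cube_le_of_biLoc (hrr : rr ∈ box (d + 1) Lc) (m k : ℕ) (hS : LocStencil S Cs δ) (hδ : 0 < δ)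
    {E : Fin (d + 1) → (Fin (d + 1) → ℤ) → ℝ} {E₀ r : ℝ} (hr : 0 ≤ r) (hE : ∀ ν U, E ν U ≤ E₀)
    (hB : ∀ ν U, BiLoc (((((Lc ^ (k + 1) : ℕ) : ℝ)) ^ (3 * (d + 1))) •
      push₃ (legChain (respStepBmSeq (toSite rr) Lc) m k) (legChain (respStepBmSeq (toSite rr) Lc) m k) (legChain (respStepBmSeq (toSite rr) Lc) m k) S ν U)
      U U (E ν U) r)
    (κ₀ : Fin (d + 1)) (U y z : Fin (d + 1) → ℤ) (α₀ β₀ : Fin (d + 1)) :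
    |push₃ (fun _ => gaugeWt (Lc ^ (k + 1))) (fun _ => gaugeWt (Lc ^ (k + 1))) (fun _ => gaugeWt (Lc ^ (k + 1))) S κ₀ U y z (Sum.inl α₀) (Sum.inl β₀)|
      ≤ (2 * ((d : ℝ) + 1)) ^ 3 * E₀ := by
  set A : ℝ := (((Lc ^ (k + 1) : ℕ) : ℝ)) ^ (3 * (d + 1)) with hA
  set T := legChain (respStepBmSeq (toSite rr) Lc) m k with hT
  set c : ℝ := ((Lc : ℝ) ^ ((d + 1) * (k + 1)))⁻¹ with hc
  have hLc : (0 : ℝ) < (Lc : ℝ) := by exact_mod_cast Nat.pos_of_ne_zero (NeZero.ne Lc)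
  have hL1 : (0 : ℝ) < (((Lc ^ (k + 1) : ℕ) : ℝ)) := by exact_mod_cast pow_pos (Nat.pos_of_ne_zero (NeZero.ne Lc)) (k + 1)
  have hApos : 0 < A := by rw [hA]; exact pow_pos hL1 _
  -- every entry of the transported letter is `≤ E₀ ∕ A`
  have hM : ∀ ν U' x z' a b, |push₃ T T T S ν U' x z' a b| ≤ E₀ / A := by
    intro ν U' x z' a b
    have h := hB ν U' x z' a b
    rw [Pi.smul_apply, Pi.smul_apply, Pi.smul_apply, Pi.smul_apply, smul_eq_mul, abs_mul, abs_of_pos hApos] at h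
    have hexp : Real.exp (-r * (l1 (x - U') + l1 (z' - U'))) ≤ 1 :=
      Real.exp_le_one_iff.2 (by nlinarith [l1_nonneg (x - U'), l1_nonneg (z' - U')])
    have hE0 : 0 ≤ E ν U' := by
      have h0 : 0 ≤ E ν U' * Real.exp (-r * (l1 (x - U') + l1 (z' - U'))) := le_trans (by positivity) h
      exact nonneg_of_mul_nonneg_left (by rwa [mul_comm] at h0) (Real.exp_pos _)
    rw [le_div_iff₀ hApos, mul_comm]
    calc A * |push₃ T T T S ν U' x z' a b| ≤ E ν U' * Real.exp (-r * (l1 (x - U') + l1 (z' - U'))) := h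
      _ ≤ E ν U' * 1 := mul_le_mul_of_nonneg_left hexp hE0
      _ ≤ E₀ := by rw [mul_one]; exact hE ν U'
  obtain ⟨CT, mT, hmT, hTd⟩ := exists_legDecay_legChain hrr m k
  have h3 := abs_readout_le_of_entry_bound (l := T) (r := T) (w := T)
    (fun α x' κ x => hTd.abs_le hmT.le α x' κ x) (fun α x' κ => hTd.summable hmT α x' κ)
    (fun β z' κ => hTd.summable hmT β z' κ) (fun κ' u' κ u => hTd.abs_le hmT.le κ' u' κ u) hS hδ
    (fun x κ u => abs_gaugeWt_le_one _ x κ u) (fun U' κ u => abs_gaugeWt_le_one _ U' κ u)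
    (sum_legChain_sub_eq_gaugeWt hrr m k) (sum_legChain_sub_eq_gaugeWt hrr m k) (sum_legChain_sub_eq_gaugeWt hrr m k) hM κ₀ U y z α₀ β₀
  -- `c³ = A⁻¹`
  have hcA : ((Lc : ℝ) ^ ((d + 1) * (k + 1)))⁻¹ * ((((Lc : ℝ) ^ ((d + 1) * (k + 1)))⁻¹) * ((((Lc : ℝ) ^ ((d + 1) * (k + 1)))⁻¹)
      * push₃ (fun _ => gaugeWt (Lc ^ (k + 1))) (fun _ => gaugeWt (Lc ^ (k + 1))) (fun _ => gaugeWt (Lc ^ (k + 1))) S κ₀ U y z (Sum.inl α₀) (Sum.inl β₀)))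
      = push₃ (fun _ => gaugeWt (Lc ^ (k + 1))) (fun _ => gaugeWt (Lc ^ (k + 1))) (fun _ => gaugeWt (Lc ^ (k + 1))) S κ₀ U y z (Sum.inl α₀) (Sum.inl β₀) / A := by
    have eA : A = ((Lc : ℝ) ^ ((d + 1) * (k + 1))) ^ 3 := by
      rw [hA]; push_cast; rw [← pow_mul, ← pow_mul]; congr 1; ring
    rw [eA]
    have hL0 : (Lc : ℝ) ^ ((d + 1) * (k + 1)) ≠ 0 := pow_ne_zero _ hLc.ne'
    field_simp
  rw [hcA, abs_div, abs_of_pos hApos, div_le_iff₀ hApos] at h3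
  calc _ ≤ (2 * ((d : ℝ) + 1)) ^ 3 * (E₀ / A) * A := h3
    _ = (2 * ((d : ℝ) + 1)) ^ 3 * E₀ := by field_simp

/-- NOT IN PRINT; OUR BOOKKEEPING.  **AT THE END's GENERIC-`d` `hLT` PROFILE** (`WardRemainderEndThreeCoDress.wLocStencil_unitS_of_layer_coDress`'s row, one sub-letter, base
level `m`, depth `k`; `K ≥ 0`, `0 ≤ θ`, `0 < κ₁`, `0 < δ₁`, any centre `yv`):
`(∀ ν U, BiLoc ((((Lc^(k+1):ℕ):ℝ)^{3(d+1)}) • push₃ T T T S ν U) U U (K·θ^{k+1}·e^{−min(κ₁∕2,δ₁∕2)‖yv − U‖₁}) (κ₁∕4)) ⟹ |push₃ Γ Γ Γ S κ₀ U y z (inl α₀) (inl β₀)| ≤ (2(d+1))³·(K·θ^{k+1})`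
— THE DISPLAYED GEOMETRIC RATE MUST BE CARRIED BY THE BORN SUB-LETTER's TRIPLE FACE CHARGE ITSELF. -/
theorem abs_push₃_gauge_cube_le_of_layerBound (hrr : rr ∈ box (d + 1) Lc) (m k : ℕ) (hS : LocStencil S Cs δ) (hδ : 0 < δ)
    {K θ κ₁ δ₁ : ℝ} (hK : 0 ≤ K) (hθ : 0 ≤ θ) (hκ₁ : 0 < κ₁) (hδ₁ : 0 < δ₁) (yv : Fin (d + 1) → ℤ)
    (hLT : ∀ ν U, BiLoc (((((Lc ^ (k + 1) : ℕ) : ℝ)) ^ (3 * (d + 1))) •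
      push₃ (legChain (respStepBmSeq (toSite rr) Lc) m k) (legChain (respStepBmSeq (toSite rr) Lc) m k) (legChain (respStepBmSeq (toSite rr) Lc) m k) S ν U)
      U U (K * θ ^ (k + 1) * Real.exp (-(min (κ₁ / 2) (δ₁ / 2)) * l1 (yv - U))) (κ₁ / 4))
    (κ₀ : Fin (d + 1)) (U y z : Fin (d + 1) → ℤ) (α₀ β₀ : Fin (d + 1)) :
    |push₃ (fun _ => gaugeWt (Lc ^ (k + 1))) (fun _ => gaugeWt (Lc ^ (k + 1))) (fun _ => gaugeWt (Lc ^ (k + 1))) S κ₀ U y z (Sum.inl α₀) (Sum.inl β₀)|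
      ≤ (2 * ((d : ℝ) + 1)) ^ 3 * (K * θ ^ (k + 1)) := by
  refine abs_push₃_gauge_cube_le_of_biLoc hrr m k hS hδ (E := fun _ U => K * θ ^ (k + 1) * Real.exp (-(min (κ₁ / 2) (δ₁ / 2)) * l1 (yv - U)))
    (r := κ₁ / 4) (by positivity) (fun ν U' => ?_) hLT κ₀ U y z α₀ β₀
  have hη : 0 ≤ min (κ₁ / 2) (δ₁ / 2) := le_min (by linarith) (by linarith)
  have hexp : Real.exp (-(min (κ₁ / 2) (δ₁ / 2)) * l1 (yv - U')) ≤ 1 :=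
    Real.exp_le_one_iff.2 (by nlinarith [l1_nonneg (yv - U')])
  calc K * θ ^ (k + 1) * Real.exp (-(min (κ₁ / 2) (δ₁ / 2)) * l1 (yv - U')) ≤ K * θ ^ (k + 1) * 1 :=
        mul_le_mul_of_nonneg_left hexp (by positivity)
    _ = K * θ ^ (k + 1) := mul_one _

/-- NOT IN PRINT; OUR BOOKKEEPING.  **NO LEVEL-FREE CONSTANT UNDER A PERSISTENT TRIPLE FACE CHARGE, GEOMETRIC RATE** (generic `d`, `0 ≤ θ < 1`): a depth-indexed family of letters
`S k` (each `LocStencil` at a positive rate) whose triple face charges at blocking `Lc^{k+1}` stay `≥ c₀ > 0` at every depth admits NO constant `K` serving the END's `hLT`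
row at every depth (centres `yv k` and rates `κ₁ k, δ₁ k > 0` may vary with `k`). -/
theorem not_exists_levelFree_layerBound_geometric (hrr : rr ∈ box (d + 1) Lc) (m : ℕ)
    {Sk : ℕ → Fin (d + 1) → (Fin (d + 1) → ℤ) → MKer (d + 1) (Fib d)} (hSk : ∀ k, ∃ Cs' δ' : ℝ, 0 < δ' ∧ LocStencil (Sk k) Cs' δ')
    {θ c₀ : ℝ} (hθ0 : 0 ≤ θ) (hθ1 : θ < 1) (hc₀ : 0 < c₀)
    (hcharge : ∀ k, ∃ (κ₀ : Fin (d + 1)) (U y z : Fin (d + 1) → ℤ) (α₀ β₀ : Fin (d + 1)),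
      c₀ ≤ |push₃ (fun _ => gaugeWt (Lc ^ (k + 1))) (fun _ => gaugeWt (Lc ^ (k + 1))) (fun _ => gaugeWt (Lc ^ (k + 1))) (Sk k) κ₀ U y z (Sum.inl α₀) (Sum.inl β₀)|) :
    ¬ ∃ K : ℝ, ∀ k, ∃ (yv : Fin (d + 1) → ℤ) (κ₁ δ₁ : ℝ), 0 < κ₁ ∧ 0 < δ₁ ∧ ∀ ν U,
      BiLoc (((((Lc ^ (k + 1) : ℕ) : ℝ)) ^ (3 * (d + 1))) •
        push₃ (legChain (respStepBmSeq (toSite rr) Lc) m k) (legChain (respStepBmSeq (toSite rr) Lc) m k) (legChain (respStepBmSeq (toSite rr) Lc) m k) (Sk k) ν U)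
        U U (K * θ ^ (k + 1) * Real.exp (-(min (κ₁ / 2) (δ₁ / 2)) * l1 (yv - U))) (κ₁ / 4) := by
  rintro ⟨K, hK⟩
  -- `K ≤ 0`: the bound forces the charge at depth `0` to vanish; `K > 0`: pick `k` with `(2(d+1))³·K·θ^{k+1} < c₀`
  rcases le_or_gt K 0 with hKn | hKn
  · obtain ⟨κ₀, U, y, z, α₀, β₀, hge⟩ := hcharge 0
    obtain ⟨yv, κ₁, δ₁, hκ₁, hδ₁, hB⟩ := hK 0
    obtain ⟨Cs', δ', hδ', hS'⟩ := hSk 0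
    -- with `K ≤ 0` the BiLoc bound forces every entry to vanish, hence the charge: contradiction with `c₀ > 0`
    have h := abs_push₃_gauge_cube_le_of_biLoc hrr m 0 hS' hδ' (E₀ := 0) (r := κ₁ / 4) (by positivity)
      (fun ν U' => by
        have : K * θ ^ (0 + 1) * Real.exp (-(min (κ₁ / 2) (δ₁ / 2)) * l1 (yv - U')) ≤ 0 :=
          mul_nonpos_of_nonpos_of_nonneg (mul_nonpos_of_nonpos_of_nonneg hKn (pow_nonneg hθ0 _)) (Real.exp_pos _).le
        exact this) hB κ₀ U y z α₀ β₀
    have : c₀ ≤ 0 := hge.trans (h.trans (by simp))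
    linarith
  · have hpos : 0 < (2 * ((d : ℝ) + 1)) ^ 3 * K := by positivity
    obtain ⟨n, hn⟩ := exists_pow_lt_of_lt_one (div_pos hc₀ hpos) hθ1
    -- at depth `k = n`: `θ^{n+1} ≤ θ^n < c₀ ∕ ((2(d+1))³ K)`
    obtain ⟨κ₀, U, y, z, α₀, β₀, hge⟩ := hcharge n
    obtain ⟨yv, κ₁, δ₁, hκ₁, hδ₁, hB⟩ := hK n
    obtain ⟨Cs', δ', hδ', hS'⟩ := hSk n
    have h := abs_push₃_gauge_cube_le_of_layerBound hrr m n hS' hδ' hKn.le hθ0 hκ₁ hδ₁ yv hB κ₀ U y z α₀ β₀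
    have hθn : θ ^ (n + 1) ≤ θ ^ n := by rw [pow_succ]; exact mul_le_of_le_one_right (pow_nonneg hθ0 _) hθ1.le
    have h' : (2 * ((d : ℝ) + 1)) ^ 3 * (K * θ ^ (n + 1)) < c₀ := by
      calc (2 * ((d : ℝ) + 1)) ^ 3 * (K * θ ^ (n + 1)) = ((2 * ((d : ℝ) + 1)) ^ 3 * K) * θ ^ (n + 1) := by ring
        _ ≤ ((2 * ((d : ℝ) + 1)) ^ 3 * K) * θ ^ n := mul_le_mul_of_nonneg_left hθn hpos.le
        _ < ((2 * ((d : ℝ) + 1)) ^ 3 * K) * (c₀ / ((2 * ((d : ℝ) + 1)) ^ 3 * K)) := mul_lt_mul_of_pos_left hn hpos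
        _ = c₀ := by field_simp
    linarith [hge.trans h]
end Chain

/-! ## §5 `d = 3`: the END `wLocStencil_unitS_coDress_three`'s `hLT` row, token for token -/
section Three

variable {Lc : ℕ} [NeZero Lc] {rr : Fin (3 + 1) → ℕ}
  {S : Fin (3 + 1) → (Fin (3 + 1) → ℤ) → MKer (3 + 1) (Fib 3)} {Cs δ : ℝ}

/-- NOT IN PRINT; OUR BOOKKEEPING.  **`d = 3`, THE LITERAL-SOCKET CURRENCY**: the END's `hLT` row for ONE sub-letter `S` at base level `m`, depth `k`, centre `yv`
(`WardRemainderEndThreeCoDress.wLocStencil_unitS_coDress_three`, profile `K·(√(((Lc^(k+1):ℕ):ℝ)))⁻¹·e^{−min(κ₁∕2,δ₁∕2)‖yv − U‖₁}`, rate `κ₁∕4`; `K ≥ 0`, `κ₁, δ₁ > 0`)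
FORCES `|push₃ Γ Γ Γ S κ₀ U y z (inl α₀) (inl β₀)| ≤ 512·K·(√(Lc^(k+1)))⁻¹` for all blocks and directions (`(2·4)³ = 512`). -/
theorem abs_push₃_gauge_cube_le_of_layerBound_three (hrr : rr ∈ box (3 + 1) Lc) (m k : ℕ) (hS : LocStencil S Cs δ) (hδ : 0 < δ)
    {K κ₁ δ₁ : ℝ} (hK : 0 ≤ K) (hκ₁ : 0 < κ₁) (hδ₁ : 0 < δ₁) (yv : Fin (3 + 1) → ℤ)
    (hLT : ∀ ν U, BiLoc (((((Lc ^ (k + 1) : ℕ) : ℝ)) ^ (3 * (3 + 1))) •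
      push₃ (legChain (respStepBmSeq (toSite rr) Lc) m k) (legChain (respStepBmSeq (toSite rr) Lc) m k) (legChain (respStepBmSeq (toSite rr) Lc) m k) S ν U)
      U U (K * ((Real.sqrt (((Lc ^ (k + 1) : ℕ) : ℝ)))⁻¹ * Real.exp (-(min (κ₁ / 2) (δ₁ / 2)) * l1 (yv - U)))) (κ₁ / 4))
    (κ₀ : Fin (3 + 1)) (U y z : Fin (3 + 1) → ℤ) (α₀ β₀ : Fin (3 + 1)) :
    |push₃ (fun _ => gaugeWt (Lc ^ (k + 1))) (fun _ => gaugeWt (Lc ^ (k + 1))) (fun _ => gaugeWt (Lc ^ (k + 1))) S κ₀ U y z (Sum.inl α₀) (Sum.inl β₀)|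
      ≤ 512 * K * (Real.sqrt (((Lc ^ (k + 1) : ℕ) : ℝ)))⁻¹ := by
  have h := abs_push₃_gauge_cube_le_of_biLoc hrr m k hS hδ
    (E := fun _ U => K * ((Real.sqrt (((Lc ^ (k + 1) : ℕ) : ℝ)))⁻¹ * Real.exp (-(min (κ₁ / 2) (δ₁ / 2)) * l1 (yv - U))))
    (E₀ := K * (Real.sqrt (((Lc ^ (k + 1) : ℕ) : ℝ)))⁻¹) (r := κ₁ / 4) (by positivity) (fun ν U' => ?_) hLT κ₀ U y z α₀ β₀
  · calc _ ≤ (2 * ((3 : ℝ) + 1)) ^ 3 * (K * (Real.sqrt (((Lc ^ (k + 1) : ℕ) : ℝ)))⁻¹) := by exact_mod_cast h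
      _ = 512 * K * (Real.sqrt (((Lc ^ (k + 1) : ℕ) : ℝ)))⁻¹ := by norm_num; ring
  · have hη : 0 ≤ min (κ₁ / 2) (δ₁ / 2) := le_min (by linarith) (by linarith)
    have hexp : Real.exp (-(min (κ₁ / 2) (δ₁ / 2)) * l1 (yv - U')) ≤ 1 :=
      Real.exp_le_one_iff.2 (by nlinarith [l1_nonneg (yv - U')])
    have hs : 0 ≤ (Real.sqrt (((Lc ^ (k + 1) : ℕ) : ℝ)))⁻¹ := inv_nonneg.2 (Real.sqrt_nonneg _)
    calc K * ((Real.sqrt (((Lc ^ (k + 1) : ℕ) : ℝ)))⁻¹ * Real.exp (-(min (κ₁ / 2) (δ₁ / 2)) * l1 (yv - U')))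
        ≤ K * ((Real.sqrt (((Lc ^ (k + 1) : ℕ) : ℝ)))⁻¹ * 1) := mul_le_mul_of_nonneg_left (mul_le_mul_of_nonneg_left hexp hs) hK
      _ = K * (Real.sqrt (((Lc ^ (k + 1) : ℕ) : ℝ)))⁻¹ := by rw [mul_one]

/-- NOT IN PRINT; OUR BOOKKEEPING.  **THE PER-LABEL REFUTATION CRITERION** (`d = 3`; the gan24-refuter's (α⁹) certificate target): for a sub-letter `S` (`LocStencil` at a
positive rate), base level `m`, depth `k`, constant `K ≥ 0`, rates `κ₁, δ₁ > 0` and centre `yv`, ONE sextuple `(κ₀, U, y, z, α₀, β₀)` of coarse data with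
`512·K·(√(Lc^(k+1)))⁻¹ < |push₃ Γ Γ Γ S κ₀ U y z (inl α₀) (inl β₀)|` — a finite sum of BORN-letter entries across the boundaries of three `Lc^{k+1}`-blocks, no leg, no
transport — REFUTES the END's `hLT` row for that sub-letter with that constant. -/
theorem not_layerBound_three_of_lt_tripleFaceCharge (hrr : rr ∈ box (3 + 1) Lc) (m k : ℕ) (hS : LocStencil S Cs δ) (hδ : 0 < δ)
    {K κ₁ δ₁ : ℝ} (hK : 0 ≤ K) (hκ₁ : 0 < κ₁) (hδ₁ : 0 < δ₁) (yv : Fin (3 + 1) → ℤ)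
    {κ₀ : Fin (3 + 1)} {U y z : Fin (3 + 1) → ℤ} {α₀ β₀ : Fin (3 + 1)}
    (hbig : 512 * K * (Real.sqrt (((Lc ^ (k + 1) : ℕ) : ℝ)))⁻¹
      < |push₃ (fun _ => gaugeWt (Lc ^ (k + 1))) (fun _ => gaugeWt (Lc ^ (k + 1))) (fun _ => gaugeWt (Lc ^ (k + 1))) S κ₀ U y z (Sum.inl α₀) (Sum.inl β₀)|) :
    ¬ ∀ ν U', BiLoc (((((Lc ^ (k + 1) : ℕ) : ℝ)) ^ (3 * (3 + 1))) •
      push₃ (legChain (respStepBmSeq (toSite rr) Lc) m k) (legChain (respStepBmSeq (toSite rr) Lc) m k) (legChain (respStepBmSeq (toSite rr) Lc) m k) S ν U')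
      U' U' (K * ((Real.sqrt (((Lc ^ (k + 1) : ℕ) : ℝ)))⁻¹ * Real.exp (-(min (κ₁ / 2) (δ₁ / 2)) * l1 (yv - U')))) (κ₁ / 4) := fun hLT =>
  absurd (abs_push₃_gauge_cube_le_of_layerBound_three hrr m k hS hδ hK hκ₁ hδ₁ yv hLT κ₀ U y z α₀ β₀) (not_le.2 hbig)

/-- NOT IN PRINT; OUR BOOKKEEPING.  **NO LEVEL-FREE CONSTANT UNDER A PERSISTENT TRIPLE FACE CHARGE** (`d = 3`, `2 ≤ Lc`): a depth-indexed family of letters `S k` (each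
`LocStencil` at a positive rate) whose triple face charges at blocking `Lc^{k+1}` stay `≥ c₀ > 0` at every depth admits NO constant `K` serving the END's `d = 3` `hLT` row at
every depth — whatever the centres `yv k` and rates `κ₁ k, δ₁ k > 0` (the (UNIF) ∕ (Q-R) reading: `K` level-free).  The premise for the literal's persistent-face sub-letters
`unitS_{m+1}(Σ_{w ∈ box(Lc^k)} σ_m(Lc^k•y_v + toSite w))` is NOT supplied here: on the born Wilson span it FAILS (the charge is zero — leaf-01 g70); for the non-Wilson
components of `σ_m` and for the transported letters (PART 3) it is the OWNER's engine question E41 — OPEN. -/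
theorem not_exists_levelFree_layerBound_three (hrr : rr ∈ box (3 + 1) Lc) (hLc : 2 ≤ Lc) (m : ℕ)
    {Sk : ℕ → Fin (3 + 1) → (Fin (3 + 1) → ℤ) → MKer (3 + 1) (Fib 3)} (hSk : ∀ k, ∃ Cs' δ' : ℝ, 0 < δ' ∧ LocStencil (Sk k) Cs' δ')
    {c₀ : ℝ} (hc₀ : 0 < c₀)
    (hcharge : ∀ k, ∃ (κ₀ : Fin (3 + 1)) (U y z : Fin (3 + 1) → ℤ) (α₀ β₀ : Fin (3 + 1)),
      c₀ ≤ |push₃ (fun _ => gaugeWt (Lc ^ (k + 1))) (fun _ => gaugeWt (Lc ^ (k + 1))) (fun _ => gaugeWt (Lc ^ (k + 1))) (Sk k) κ₀ U y z (Sum.inl α₀) (Sum.inl β₀)|) :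
    ¬ ∃ K : ℝ, ∀ k, ∃ (yv : Fin (3 + 1) → ℤ) (κ₁ δ₁ : ℝ), 0 < κ₁ ∧ 0 < δ₁ ∧ ∀ ν U,
      BiLoc (((((Lc ^ (k + 1) : ℕ) : ℝ)) ^ (3 * (3 + 1))) •
        push₃ (legChain (respStepBmSeq (toSite rr) Lc) m k) (legChain (respStepBmSeq (toSite rr) Lc) m k) (legChain (respStepBmSeq (toSite rr) Lc) m k) (Sk k) ν U)
        U U (K * ((Real.sqrt (((Lc ^ (k + 1) : ℕ) : ℝ)))⁻¹ * Real.exp (-(min (κ₁ / 2) (δ₁ / 2)) * l1 (yv - U)))) (κ₁ / 4) := by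
  -- `(√(Lc^(k+1)))⁻¹ = θ^{k+1}` with `θ = (√Lc)⁻¹ ∈ [0,1)`: reduce to the geometric form
  have hLc1 : (1 : ℝ) < (Lc : ℝ) := by exact_mod_cast hLc
  have hs1 : 1 < Real.sqrt (Lc : ℝ) := by
    rw [show (1 : ℝ) = Real.sqrt 1 from Real.sqrt_one.symm]
    exact Real.sqrt_lt_sqrt zero_le_one hLc1
  have hθ0 : 0 ≤ (Real.sqrt (Lc : ℝ))⁻¹ := inv_nonneg.2 (Real.sqrt_nonneg _)
  have hθ1 : (Real.sqrt (Lc : ℝ))⁻¹ < 1 := inv_lt_one_of_one_lt₀ hs1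
  have h := not_exists_levelFree_layerBound_geometric (d := 3) hrr m hSk hθ0 hθ1 hc₀ hcharge
  rintro ⟨K, hK⟩
  refine h ⟨K, fun k => ?_⟩
  obtain ⟨yv, κ₁, δ₁, hκ₁, hδ₁, hB⟩ := hK k
  refine ⟨yv, κ₁, δ₁, hκ₁, hδ₁, fun ν U => ?_⟩
  rw [← WardRemainderTransportedLetter.inv_sqrt_natCast_pow Lc (k + 1), mul_assoc]
  exact hB ν U
end Three

end Summit.QuantumFields.BalabanUV.Beta.GAN24.TripleFaceCharge

end
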